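import Summits.Ventures.Crystal3D.Theorems.StickyWulffConstantTextureLiminfTexShadowLevelReachMultiFamilyPooled
import Summits.Ventures.Crystal3D.Theorems.StickyWulffConstantTextureLiminfTexShadowLevelReachHexagonPooledFlux
import HarnessLib

/-!
# The multi-family pooled census in FLUX form and in lane T's PAYER currency (O(ρ) rims): plates + born families under ONE bi-frame row
# (lane T, crux `TextureLiminfV5`, stmt-Ventures-23912, registered stub `stub_terraceCensus`; (β) assembly RESUME (d) — cf-p1 (cccxii))

HONEST FRAMING. Venture `Summits/Ventures/Crystal3D` (cell `crystal3d-full`), route `route-Ventures-StickyWulffConstant`, helper `--supports` the law-v5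
crux `TextureLiminfV5` (stmt-Ventures-23912), lane T, mechanism (β).  Census-free, certificate-free: the row `LocalEndRowA ver sF (basalSystem Fr) (basalSystem G₂)`
BY NAME (any `sF ≥ 0`); `KissingGap δ` / `KissingClassification δ` by name; nothing about energies; F-C1 not moved.

THE POINT.  `multiFamily_sources_le_payers_cuts` (…LevelReachMultiFamilyPooled) with the two plate source sums replaced by lane F's FLUX lower bounds
(`oneFcc_srcA_ge`, `topPlate_flux_le_sources` — exactly as in `hexagon_twoPlate_flux_le_payers_cuts`, p748129) and then the widened payer window and all rims
priced in `ρ` (`widenedPayerSum_le`, `card_band_annulus₃_le/₂_le`, `#RT ≤ 12`):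
* `multiFamily_flux_le_payers_cuts` — `flux₁(Kw₁) + flux₂(Kw₂) + Σ_i #(B i)_win + Σ_j #(B' j)_win ≤ sF·Σ_PAYW + ΣCUT₁ + ΣCUT₂ + Σ_i CUT_i + Σ_j CUT_j + rims`;
* **`multiFamily_flux_le_payerSum`** — the same in lane T's payer currency `PAY = {deg ≠ 12, −R₀−2 ≤ y₂ ≤ h+R₀+2}`:
  `… ≤ sF·Σ_PAY(12 − deg) + ΣCUT₁ + ΣCUT₂ + Σ_i CUT_i + Σ_j CUT_j + (3456·sF + 1710720 + 71280·(|ι₁| + |ι₂|))·ρ`.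
So the (β) census of record now reads, in the kernel: plate hexagon flux + BORN launches of the presentable lamella families ≤ sF × (lane T's deficiency sum)
+ located cut terms + O(ρ) — the born launch counts being the SUPPLY the riser law must bound below (PRESENTABLE-SUPPLY-g24: margin ≥ 1.16 with them).
WHAT THIS IS NOT: born SUPPLY, the flux-to-area evaluation, ΣCUT sizing, any certificate; F-C1 not moved.
-/

noncomputable section

namespace Summit.Ventures.Crystal3D.Theorems

open Summit.Ventures.Crystal3D Finset
open Literature.MathematicalPhysics.StatisticalMechanics (barlowPos barlowStacking IsHaggSeq barlowPos_mem basalMirror)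
open Summit.Ventures.Crystal3D.Cruxes.TextureLiminf.TexShadow (E3 stacking)
open scoped InnerProductSpace

section Flux

variable (ver : WordVersion) {δ : ℝ} (hg : KissingGap δ) (hc : KissingClassification δ)
    {σ₁ σ₂ : ℤ → ℤ} (hσ₁ : IsHaggSeq σ₁) (hσ₂ : IsHaggSeq σ₂) (L₁ L₂ : E3 ≃ₗᵢ[ℝ] E3) (s₁ s₂ : E3)
    (Fr : E3 ≃ₗᵢ[ℝ] E3) {t : ℤ} (hFr : (t = 1 ∧ Fr = L₁) ∨ (t = -1 ∧ Fr = basalMirror.trans L₁))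
    (G₂ : E3 ≃ₗᵢ[ℝ] E3) {t' : ℤ} (hG₂ : (t' = 1 ∧ G₂ = L₂) ∨ (t' = -1 ∧ G₂ = basalMirror.trans L₂))
    (hne₁ : (Fr : E3 → E3) '' ↑fccSlots ≠ (L₂ : E3 → E3) '' ↑fccSlots)
    (hne₂ : (Fr : E3 → E3) '' ↑fccSlots ≠ ((basalMirror.trans L₂ : E3 ≃ₗᵢ[ℝ] E3) : E3 → E3) '' ↑fccSlots)
    (hne₁' : (G₂ : E3 → E3) '' ↑fccSlots ≠ (L₁ : E3 → E3) '' ↑fccSlots)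
    (hne₂' : (G₂ : E3 → E3) '' ↑fccSlots ≠ ((basalMirror.trans L₁ : E3 ≃ₗᵢ[ℝ] E3) : E3 → E3) '' ↑fccSlots)
    {sF : ℝ} (hrow : LocalEndRowA ver sF (basalSystem Fr) (basalSystem G₂))
    (X P₁ P₂ : Finset E3) (R₀ h ρ : ℝ) (hR₀ : 5 ≤ R₀) (hh : 0 ≤ h) (hρ : R₀ + 2 ≤ ρ)
    (hX : ∀ p ∈ X, ∀ q ∈ X, p ≠ q → 1 ≤ dist p q) (hP₁X : P₁ ⊆ X) (hP₂X : P₂ ⊆ X)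
    (hP₁ : ∀ p, p ∈ P₁ ↔ (p ∈ stacking L₁ s₁ σ₁ ∧ -(2 * R₀) ≤ p 2 ∧ p 2 ≤ -R₀ ∧ p 0 ^ 2 + p 1 ^ 2 ≤ ρ ^ 2))
    (hP₂ : ∀ p, p ∈ P₂ ↔ (p ∈ stacking L₂ s₂ σ₂ ∧ h + R₀ ≤ p 2 ∧ p 2 ≤ h + 2 * R₀ ∧ p 0 ^ 2 + p 1 ^ 2 ≤ ρ ^ 2))
    {ι₁ : Type*} [Fintype ι₁] (A : ι₁ → (E3 ≃ₗᵢ[ℝ] E3)) (w : ι₁ → E3) (B : ι₁ → Finset E3)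
    (hneA : ∀ i, (A i : E3 → E3) '' ↑fccSlots ≠ (L₂ : E3 → E3) '' ↑fccSlots)
    (hneA' : ∀ i, (A i : E3 → E3) '' ↑fccSlots ≠ ((basalMirror.trans L₂ : E3 ≃ₗᵢ[ℝ] E3) : E3 → E3) '' ↑fccSlots)
    (hw : ∀ i, w i ∈ fccSlots) (hup : ∀ i, 0 < (A i (w i)) 2)
    (hadm₁ : ∀ i, (basalSystem Fr).Adm (A i) (A i (w i)) ∨ (basalSystem G₂).Adm (A i) (A i (w i)))
    (hdir₁ : ∀ i, ∀ r ∈ basalHexagon, A i (w i) ≠ Fr r) (hinj₁ : ∀ i i', A i (w i) = A i' (w i') → i = i')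
    (hborn₁ : ∀ i, ∀ p ∈ B i, p ∈ X ∧ IsFull X (A i) p ∧ p - A i (w i) ∈ X ∧
      ¬ (p - A i (w i) - A i (w i) ∈ X ∧
        (IsFull X (A i) (p - A i (w i)) ∨ (∃ m, IsTwinReading X (A i) m (p - A i (w i)) ∧ ⟪A i (w i), m⟫_ℝ = 0) ∨
          (ver = WordVersion.v2 ∧ IsNarrow X (A i) (A i (w i)) (p - A i (w i))))))
    {ι₂ : Type*} [Fintype ι₂] (A' : ι₂ → (E3 ≃ₗᵢ[ℝ] E3)) (w' : ι₂ → E3) (B' : ι₂ → Finset E3)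
    (hneB : ∀ j, (A' j : E3 → E3) '' ↑fccSlots ≠ (L₁ : E3 → E3) '' ↑fccSlots)
    (hneB' : ∀ j, (A' j : E3 → E3) '' ↑fccSlots ≠ ((basalMirror.trans L₁ : E3 ≃ₗᵢ[ℝ] E3) : E3 → E3) '' ↑fccSlots)
    (hw' : ∀ j, w' j ∈ fccSlots) (hdown : ∀ j, (A' j (w' j)) 2 < 0)
    (hadm₂ : ∀ j, (basalSystem Fr).Adm (A' j) (A' j (w' j)) ∨ (basalSystem G₂).Adm (A' j) (A' j (w' j)))
    (hdir₂ : ∀ j, ∀ r ∈ basalHexagon, A' j (w' j) ≠ G₂ r) (hinj₂ : ∀ j j', A' j (w' j) = A' j' (w' j') → j = j')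
    (hborn₂ : ∀ j, ∀ p ∈ B' j, p ∈ X ∧ IsFull X (A' j) p ∧ p - A' j (w' j) ∈ X ∧
      ¬ (p - A' j (w' j) - A' j (w' j) ∈ X ∧
        (IsFull X (A' j) (p - A' j (w' j)) ∨ (∃ m, IsTwinReading X (A' j) m (p - A' j (w' j)) ∧ ⟪A' j (w' j), m⟫_ℝ = 0) ∨
          (ver = WordVersion.v2 ∧ IsNarrow X (A' j) (A' j (w' j)) (p - A' j (w' j))))))
include hg hc hσ₁ hσ₂ hFr hG₂ hne₁ hne₂ hne₁' hne₂' hrow hR₀ hh hρ hX hP₁X hP₂X hP₁ hP₂ hneA hneA' hw hup hadm₁ hdir₁ hinj₁ hborn₁ hneB hneB'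
  hw' hdown hadm₂ hdir₂ hinj₂ hborn₂

open scoped Classical in
/-- **Flux form**: the two plate source sums of `multiFamily_sources_le_payers_cuts` replaced by lane F's flux lower bounds (`oneFcc_srcA_ge`,
`topPlate_flux_le_sources`), any layer sets `Kw₁`, `Kw₂`. -/
theorem multiFamily_flux_le_payers_cuts (Kw₁ Kw₂ : Finset ℤ) :
    ∑ k ∈ Kw₁, (if ¬ (σ₁ (k - 1) = -t ∧ σ₁ k = -t) then (1 : ℝ) else 0) *
        (4 * (∑ r ∈ inPlaneRoots Fr 1, (Fr r) 2) / (Real.sqrt 3 * (1 - (L₁.symm (EuclideanSpace.single (2 : Fin 3) (1 : ℝ))) 2 ^ 2)) *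
          Real.sqrt (max 0 ((ρ - 4) ^ 2 * (1 - (L₁.symm (EuclideanSpace.single (2 : Fin 3) (1 : ℝ))) 2 ^ 2) -
            ((k : ℝ) * Real.sqrt (2 / 3) + (L₁.symm s₁) 2 -
              (-(R₀ + 1) - 1) * (L₁.symm (EuclideanSpace.single (2 : Fin 3) (1 : ℝ))) 2) ^ 2)) -
          ((inPlaneRoots Fr 1).card : ℝ)) +
      ∑ k ∈ Kw₂, (if ¬ (σ₂ (k - 1) = -t' ∧ σ₂ k = -t') then (1 : ℝ) else 0) *
        (4 * (∑ r ∈ inPlaneRoots G₂ (-1), -(G₂ r) 2) / (Real.sqrt 3 * (1 - (L₂.symm (EuclideanSpace.single (2 : Fin 3) (1 : ℝ))) 2 ^ 2)) *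
          Real.sqrt (max 0 ((ρ - 4) ^ 2 * (1 - (L₂.symm (EuclideanSpace.single (2 : Fin 3) (1 : ℝ))) 2 ^ 2) -
            ((k : ℝ) * Real.sqrt (2 / 3) + (L₂.symm s₂) 2 -
              (h + (R₀ + 1) + 1) * (L₂.symm (EuclideanSpace.single (2 : Fin 3) (1 : ℝ))) 2) ^ 2)) -
          ((inPlaneRoots G₂ (-1)).card : ℝ)) +
      ((∑ i, ((B i).filter fun p => -(R₀ + 1) - 1 < (p + A i (w i)) 2 ∧ (p + A i (w i)) 2 < h + (R₀ + 1) + 1).card : ℕ) : ℝ) +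
      ((∑ j, ((B' j).filter fun p => -(R₀ + 1) - 1 < (p + A' j (w' j)) 2 ∧ (p + A' j (w' j)) 2 < h + (R₀ + 1) + 1).card : ℕ) : ℝ) ≤
      sF * ∑ z ∈ X.filter (fun z => (X.filter fun q => dist z q = 1).card ≤ 11 ∧
          -(R₀ + 1) - 2 ≤ z 2 ∧ z 2 ≤ h + (R₀ + 1) + 2), ((12 : ℝ) - ((X.filter fun q => dist z q = 1).card : ℝ)) +
        ((∑ r ∈ inPlaneRoots Fr 1, (X.filter fun b => -(R₀ + 1) - 1 ≤ b 2 ∧ b 2 < h + (R₀ + 1) + 1 ∧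
            (∃ μ, ⟪r, μ⟫_ℝ = Real.sqrt (2 / 3) ∧ IsTwinReading X Fr (Fr μ) b) ∧ b - Fr r ∈ X).card : ℕ) : ℝ) +
        ((∑ r ∈ inPlaneRoots G₂ (-1), (X.filter fun b => -(R₀ + 1) - 1 < b 2 ∧ b 2 ≤ h + (R₀ + 1) + 1 ∧
            (∃ μ, ⟪r, μ⟫_ℝ = Real.sqrt (2 / 3) ∧ IsTwinReading X G₂ (G₂ μ) b) ∧ b - G₂ r ∈ X).card : ℕ) : ℝ) +
        ((∑ i, (X.filter fun b => -(R₀ + 1) - 1 ≤ b 2 ∧ b 2 < h + (R₀ + 1) + 1 ∧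
            (∃ μ, ⟪w i, μ⟫_ℝ = Real.sqrt (2 / 3) ∧ IsTwinReading X (A i) (A i μ) b) ∧ b - A i (w i) ∈ X).card : ℕ) : ℝ) +
        ((∑ j, (X.filter fun b => -(R₀ + 1) - 1 < b 2 ∧ b 2 ≤ h + (R₀ + 1) + 1 ∧
            (∃ μ, ⟪w' j, μ⟫_ℝ = Real.sqrt (2 / 3) ∧ IsTwinReading X (A' j) (A' j μ) b) ∧ b - A' j (w' j) ∈ X).card : ℕ) : ℝ) +
        (((inPlaneRoots Fr 1).card : ℝ) + (Fintype.card ι₁ : ℝ)) *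
          (220 * ((X.filter fun s => h + (R₀ + 1) + 1 ≤ s 2 ∧ s 2 ≤ h + (R₀ + 1) + 1 + 1 ∧
              (ρ - 1 - 2) ^ 2 < s 0 ^ 2 + s 1 ^ 2).card : ℝ) +
            220 * ((X.filter fun s => -(R₀ + 1) - 1 - 1 ≤ s 2 ∧ s 2 < -(R₀ + 1) - 1 ∧
              (ρ - 1 - 1) ^ 2 < s 0 ^ 2 + s 1 ^ 2).card : ℝ)) +
        (((inPlaneRoots G₂ (-1)).card : ℝ) + (Fintype.card ι₂ : ℝ)) *
          (220 * ((X.filter fun s => -(R₀ + 1) - 1 - 1 ≤ s 2 ∧ s 2 ≤ -(R₀ + 1) - 1 ∧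
              (ρ - 1 - 2) ^ 2 < s 0 ^ 2 + s 1 ^ 2).card : ℝ) +
            220 * ((X.filter fun s => h + (R₀ + 1) + 1 < s 2 ∧ s 2 ≤ h + (R₀ + 1) + 1 + 1 ∧
              (ρ - 1 - 1) ^ 2 < s 0 ^ 2 + s 1 ^ 2).card : ℝ)) := by
  have h0₁ := oneFcc_srcA_ge L₁ s₁ Fr (fun r hr => frame_apply_basal hFr hr) t P₁ R₀ h ρ (by linarith) hh (by linarith) hP₁ Kw₁
  have h0₂ := topPlate_flux_le_sources L₂ s₂ G₂ hG₂ P₂ R₀ h ρ (by linarith) hh (by linarith) hP₂ Kw₂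
  have h1 := multiFamily_sources_le_payers_cuts ver hg hc hσ₁ hσ₂ L₁ L₂ s₁ s₂ Fr hFr G₂ hG₂ hne₁ hne₂ hne₁' hne₂' hrow X P₁ P₂
    R₀ h ρ hR₀ hρ hX hP₁X hP₂X hP₁ hP₂ A w B hneA hneA' hw hup hadm₁ hdir₁ hinj₁ hborn₁ A' w' B' hneB hneB' hw' hdown hadm₂ hdir₂ hinj₂ hborn₂
  linarith only [h0₁, h0₂, h1]

open scoped Classical in
/-- **Payer-currency form** (lane T's `PAY = {deg ≠ 12, −R₀−2 ≤ y₂ ≤ h+R₀+2}`, rims in `ρ`; needs `0 ≤ sF` and the cell containment `hcell`). -/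
theorem multiFamily_flux_le_payerSum (hsF : 0 ≤ sF)
    (hcell : ∀ p ∈ X, -(2 * R₀) ≤ p 2 ∧ p 2 ≤ h + 2 * R₀ ∧ p 0 ^ 2 + p 1 ^ 2 ≤ ρ ^ 2) (Kw₁ Kw₂ : Finset ℤ) :
    ∑ k ∈ Kw₁, (if ¬ (σ₁ (k - 1) = -t ∧ σ₁ k = -t) then (1 : ℝ) else 0) *
        (4 * (∑ r ∈ inPlaneRoots Fr 1, (Fr r) 2) / (Real.sqrt 3 * (1 - (L₁.symm (EuclideanSpace.single (2 : Fin 3) (1 : ℝ))) 2 ^ 2)) *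
          Real.sqrt (max 0 ((ρ - 4) ^ 2 * (1 - (L₁.symm (EuclideanSpace.single (2 : Fin 3) (1 : ℝ))) 2 ^ 2) -
            ((k : ℝ) * Real.sqrt (2 / 3) + (L₁.symm s₁) 2 -
              (-(R₀ + 1) - 1) * (L₁.symm (EuclideanSpace.single (2 : Fin 3) (1 : ℝ))) 2) ^ 2)) -
          ((inPlaneRoots Fr 1).card : ℝ)) +
      ∑ k ∈ Kw₂, (if ¬ (σ₂ (k - 1) = -t' ∧ σ₂ k = -t') then (1 : ℝ) else 0) *
        (4 * (∑ r ∈ inPlaneRoots G₂ (-1), -(G₂ r) 2) / (Real.sqrt 3 * (1 - (L₂.symm (EuclideanSpace.single (2 : Fin 3) (1 : ℝ))) 2 ^ 2)) *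
          Real.sqrt (max 0 ((ρ - 4) ^ 2 * (1 - (L₂.symm (EuclideanSpace.single (2 : Fin 3) (1 : ℝ))) 2 ^ 2) -
            ((k : ℝ) * Real.sqrt (2 / 3) + (L₂.symm s₂) 2 -
              (h + (R₀ + 1) + 1) * (L₂.symm (EuclideanSpace.single (2 : Fin 3) (1 : ℝ))) 2) ^ 2)) -
          ((inPlaneRoots G₂ (-1)).card : ℝ)) +
      ((∑ i, ((B i).filter fun p => -(R₀ + 1) - 1 < (p + A i (w i)) 2 ∧ (p + A i (w i)) 2 < h + (R₀ + 1) + 1).card : ℕ) : ℝ) +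
      ((∑ j, ((B' j).filter fun p => -(R₀ + 1) - 1 < (p + A' j (w' j)) 2 ∧ (p + A' j (w' j)) 2 < h + (R₀ + 1) + 1).card : ℕ) : ℝ) ≤
      sF * ∑ y ∈ X.filter (fun y => (X.filter fun q => dist y q = 1).card ≠ 12 ∧ -R₀ - 2 ≤ y 2 ∧ y 2 ≤ h + R₀ + 2),
          ((12 : ℝ) - ((X.filter fun q => dist y q = 1).card : ℝ)) +
        ((∑ r ∈ inPlaneRoots Fr 1, (X.filter fun b => -(R₀ + 1) - 1 ≤ b 2 ∧ b 2 < h + (R₀ + 1) + 1 ∧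
            (∃ μ, ⟪r, μ⟫_ℝ = Real.sqrt (2 / 3) ∧ IsTwinReading X Fr (Fr μ) b) ∧ b - Fr r ∈ X).card : ℕ) : ℝ) +
        ((∑ r ∈ inPlaneRoots G₂ (-1), (X.filter fun b => -(R₀ + 1) - 1 < b 2 ∧ b 2 ≤ h + (R₀ + 1) + 1 ∧
            (∃ μ, ⟪r, μ⟫_ℝ = Real.sqrt (2 / 3) ∧ IsTwinReading X G₂ (G₂ μ) b) ∧ b - G₂ r ∈ X).card : ℕ) : ℝ) +
        ((∑ i, (X.filter fun b => -(R₀ + 1) - 1 ≤ b 2 ∧ b 2 < h + (R₀ + 1) + 1 ∧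
            (∃ μ, ⟪w i, μ⟫_ℝ = Real.sqrt (2 / 3) ∧ IsTwinReading X (A i) (A i μ) b) ∧ b - A i (w i) ∈ X).card : ℕ) : ℝ) +
        ((∑ j, (X.filter fun b => -(R₀ + 1) - 1 < b 2 ∧ b 2 ≤ h + (R₀ + 1) + 1 ∧
            (∃ μ, ⟪w' j, μ⟫_ℝ = Real.sqrt (2 / 3) ∧ IsTwinReading X (A' j) (A' j μ) b) ∧ b - A' j (w' j) ∈ X).card : ℕ) : ℝ) +
        (3456 * sF + 1710720 + 71280 * ((Fintype.card ι₁ : ℝ) + (Fintype.card ι₂ : ℝ))) * ρ := by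
  have hflux := multiFamily_flux_le_payers_cuts ver hg hc hσ₁ hσ₂ L₁ L₂ s₁ s₂ Fr hFr G₂ hG₂ hne₁ hne₂ hne₁' hne₂' hrow X P₁ P₂
    R₀ h ρ hR₀ hh hρ hX hP₁X hP₂X hP₁ hP₂ A w B hneA hneA' hw hup hadm₁ hdir₁ hinj₁ hborn₁ A' w' B' hneB hneB' hw' hdown hadm₂ hdir₂ hinj₂
    hborn₂ Kw₁ Kw₂
  have hPAYW := widenedPayerSum_le hσ₁ hσ₂ L₁ L₂ s₁ s₂ hX hP₁X hP₂X hcell hP₁ hP₂ (by linarith) (by linarith)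
  have hmono := mul_le_mul_of_nonneg_left hPAYW hsF
  -- the four rim counts
  have hsepX : ∀ (S : Finset E3), S ⊆ X → ∀ p ∈ S, ∀ q ∈ S, p ≠ q → 1 ≤ dist p q :=
    fun S hS p hp q hq hpq => hX p (hS hp) q (hS hq) hpq
  have hrimT : ((X.filter fun s => h + (R₀ + 1) + 1 ≤ s 2 ∧ s 2 ≤ h + (R₀ + 1) + 1 + 1 ∧
      (ρ - 1 - 2) ^ 2 < s 0 ^ 2 + s 1 ^ 2).card : ℝ) ≤ 180 * ρ :=
    card_band_annulus₃_le _ (hsepX _ (filter_subset _ _)) (h + (R₀ + 1) + 1) ρ (by linarith)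
      (fun p hp => by
        obtain ⟨hpX, h1, h2, h3⟩ := mem_filter.1 hp
        exact ⟨h1, h2, h3, (hcell p hpX).2.2⟩)
  have hrimB : ((X.filter fun s => -(R₀ + 1) - 1 - 1 ≤ s 2 ∧ s 2 < -(R₀ + 1) - 1 ∧
      (ρ - 1 - 1) ^ 2 < s 0 ^ 2 + s 1 ^ 2).card : ℝ) ≤ 144 * ρ :=
    card_band_annulus₂_le _ (hsepX _ (filter_subset _ _)) (-(R₀ + 1) - 1 - 1) ρ (by linarith)
      (fun p hp => by
        obtain ⟨hpX, h1, h2, h3⟩ := mem_filter.1 hp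
        exact ⟨h1, by linarith, h3, (hcell p hpX).2.2⟩)
  have hrim₁ : ((X.filter fun s => -(R₀ + 1) - 1 - 1 ≤ s 2 ∧ s 2 ≤ -(R₀ + 1) - 1 ∧
      (ρ - 1 - 2) ^ 2 < s 0 ^ 2 + s 1 ^ 2).card : ℝ) ≤ 180 * ρ :=
    card_band_annulus₃_le _ (hsepX _ (filter_subset _ _)) (-(R₀ + 1) - 1 - 1) ρ (by linarith)
      (fun p hp => by
        obtain ⟨hpX, h1, h2, h3⟩ := mem_filter.1 hp
        exact ⟨h1, by linarith, h3, (hcell p hpX).2.2⟩)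
  have hrim₂ : ((X.filter fun s => h + (R₀ + 1) + 1 < s 2 ∧ s 2 ≤ h + (R₀ + 1) + 1 + 1 ∧
      (ρ - 1 - 1) ^ 2 < s 0 ^ 2 + s 1 ^ 2).card : ℝ) ≤ 144 * ρ :=
    card_band_annulus₂_le _ (hsepX _ (filter_subset _ _)) (h + (R₀ + 1) + 1) ρ (by linarith)
      (fun p hp => by
        obtain ⟨hpX, h1, h2, h3⟩ := mem_filter.1 hp
        exact ⟨h1.le, h2, h3, (hcell p hpX).2.2⟩)
  have hRT₁ : ((inPlaneRoots Fr 1).card : ℝ) ≤ 12 := by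
    have : (inPlaneRoots Fr 1).card ≤ 12 := (card_le_card (filter_subset _ _)).trans (by rw [card_fccSlots])
    exact_mod_cast this
  have hRT₂ : ((inPlaneRoots G₂ (-1)).card : ℝ) ≤ 12 := by
    have : (inPlaneRoots G₂ (-1)).card ≤ 12 := (card_le_card (filter_subset _ _)).trans (by rw [card_fccSlots])
    exact_mod_cast this
  have hprod : ∀ a n b c : ℝ, 0 ≤ a → a ≤ 12 → 0 ≤ n → 0 ≤ b → b ≤ 180 * ρ → 0 ≤ c → c ≤ 144 * ρ →
      (a + n) * (220 * b + 220 * c) ≤ 855360 * ρ + 71280 * n * ρ := by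
    intro a n b c ha ha' hn hb hb' hc hc'
    nlinarith [mul_nonneg hn hb, mul_nonneg hn hc]
  have hrims₁ := hprod _ _ _ _ (Nat.cast_nonneg _) hRT₁ (Nat.cast_nonneg (Fintype.card ι₁)) (Nat.cast_nonneg _) hrimT
    (Nat.cast_nonneg _) hrimB
  have hrims₂ := hprod _ _ _ _ (Nat.cast_nonneg _) hRT₂ (Nat.cast_nonneg (Fintype.card ι₂)) (Nat.cast_nonneg _) hrim₁
    (Nat.cast_nonneg _) hrim₂
  nlinarith only [hflux, hmono, hrims₁, hrims₂, Nat.cast_nonneg (α := ℝ) (Fintype.card ι₁), Nat.cast_nonneg (α := ℝ) (Fintype.card ι₂)]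

end Flux

end Summit.Ventures.Crystal3D.Theorems

end
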